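import Summits.ResolutionOfSingularities.ResolutionOfSingularities.Theorems.EquisingularLiftEquisingularLiftNatTowerCurveStepThree
import Summits.ResolutionOfSingularities.ResolutionOfSingularities.Theorems.EquisingularLiftEquisingularLiftNatTowerInvBDefs
import Summits.ResolutionOfSingularities.ResolutionOfSingularities.Theorems.EquisingularLiftEquisingularLiftNatStrictTransformFlat
import Summits.ResolutionOfSingularities.ResolutionOfSingularities.Theorems.EquisingularLiftEquisingularLiftCentreBlowupFlatExceptional
import Summits.ResolutionOfSingularities.ResolutionOfSingularities.Theorems.EquisingularLiftEquisingularLiftNatSubchainSupplierInvSZeroDefs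
import Summits.ResolutionOfSingularities.ResolutionOfSingularities.Theorems.EquisingularLiftEquisingularLiftNatTowerInvBFourDefs
import Summits.ResolutionOfSingularities.ResolutionOfSingularities.Theorems.EquisingularLiftEquisingularLiftNatSubchainSupplierInvSZeroLDefs
import HarnessLib

/-!
# [OURS · L1 W4.5(b) · EL♮(3) · T23-A‴ (U6), SHADOW-FREE ARM] THE SHADOW-FREE CURVE STEP AT AN EXPLICIT STAGE WITH EXPLICIT OUTPUTS, RE-CUT AT `Tower.Exc₄`:
# `Tower.stageB₄_of_memberS₀At_curveStep` — res-type-027's R5 `Tower.invB_of_invS₀_curveStep_forget` (…NatTowerCurveStepBSZero p620812) restated on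
# `TCPlus.MemberS₀At` (…NatSubchainSupplierInvSZeroLDefs p629628) and RETURNING the carrier round's blow-up `τ`, the model square `(j₂, t₂)`, the centre facts
# and the two `Exc₄` data (running surface `υ'⁻¹Z₉`, shadow `St K₉ = ∅` forgotten; seeded member `St S₉` with model `St_{𝓢 ⊔ K} 𝓢`) IN THAT STAGE — the twin
# of …NatTowerCurveStepBSAt p628788 (res-L1-w45b-stub-4's request 2026-08-28T11:24:07Z: the plane list in the `K₂ = ∅` arm too)

res-type-027 g18 ((U6) owner), brick (G6a). OURS; NOT a statement of any manuscript ([Hironaka2017] is a candidate under adjudication, nothing of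
it is asserted); AI-written, weaker than expert review. No `sorry`; standard axioms; DEF-FREE; `--supports stmt-ResolutionOfSingularities-20148 --as helper`.
PROOF = p620812's VERBATIM (generic `Ruled`, stand-ins `hRuled` / `hRuledS`), the final anonymous constructor opened and the `Exc₃` data re-cut as `Exc₄`.
[cite: GortzWedhorn2020, Prop. 13.91 and (13.19)] [cite: Liu2002, Thm. 8.1.19] [cite: Matsumura1987, Thm. 14.2] [cite: StacksProject, Tag 01WS]
-/

set_option linter.dupNamespace false -- mandated namespace `Summit.<Summit>.<Problem>` of this single-conjunct summit
set_option linter.overlappingInstances false -- signatures carry `[IsDomain O] [IsDiscreteValuationRing O]`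

noncomputable section

open CategoryTheory CategoryTheory.Limits AlgebraicGeometry TopologicalSpace Topology IsLocalRing
open Literature.AlgebraicGeometry.Resolution
open AlgebraicGeometry.Scheme.IdealSheafData
open Summit.ResolutionOfSingularities.ResolutionOfSingularities.Theses.EquisingularLift.Split
open Summit.ResolutionOfSingularities.ResolutionOfSingularities.Cruxes.EquisingularLift.StrataSplit

namespace Summit.ResolutionOfSingularities.ResolutionOfSingularities.Cruxes.EquisingularLiftNat.Sections

set_option maxHeartbeats 800000 in -- one large refine over a 20-clause invariant (as res-D-pv-029's brick)
/-- **The shadow-free curve step at an explicit stage, explicit outputs, at `Exc₄`** (see the module docstring). [cite: GortzWedhorn2020, Prop. 13.91 and (13.19)]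
[cite: Liu2002, Thm. 8.1.19] [cite: Matsumura1987, Thm. 14.2] [OURS · L1 W4.5b · T23-A‴ (U6)] brick (G6a) (stmt-ResolutionOfSingularities-20148);
NOT a statement of the manuscript. -/
theorem Tower.stageB₄_of_memberS₀At_curveStep (O : Type) [CommRing O] [IsDomain O] [IsDiscreteValuationRing O] (k : Type) [Field k]
    (θ : O →+* k) (hθ : Function.Surjective θ)
    (P : Scheme.{0}) (q : P ⟶ Spec (.of O)) [IsProper q] (Y : Set P) (hYsp : Y ⊆ q ⁻¹' {closedPoint O})
    (hYirr : IsIrreducible Y) (hYcl : IsClosed Y)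
    (hPnoeth : IsLocallyNoetherian P) (hPreg : Scheme.IsRegular P)
    (Ch : ∀ X' : Scheme.{0}, (X' ⟶ P) → Set X' → Prop)
    (hChain : ∀ (X' : Scheme.{0}) (σ : X' ⟶ P) (S : Set X'), Ch X' σ S → Chain P Y X' σ S)
    (hStep : ∀ (X' X'' : Scheme.{0}) (σ' : X' ⟶ P) (S' : Set X') (C : X'.IdealSheafData) (τ : X'' ⟶ X'),
      Ch X' σ' S' → IsBlowup τ C → Scheme.IsRegular C.subscheme → Flat (C.subschemeι ≫ σ' ≫ q) →
      σ' '' (C.support : Set X') ⊆ {x : P | ¬ IsGenericPoint x Y} →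
      (C.support : Set X') ∩ (σ' ≫ q) ⁻¹' {IsLocalRing.closedPoint O} ⊆ S' →
      Ch X'' (τ ≫ σ') (closure (τ ⁻¹' (S' \ (C.support : Set X')))))
    (Ruled : Tower.RuledDatum P)
    (F₉ : Scheme.{0}) [IsIntegral F₉] (T₉ Z₉ K₉ S₉ : Set F₉) (hZ₉ : IsClosed Z₉) (hT₉irr : IsIrreducible T₉)
    (F₁₀ : Scheme.{0}) (υ' : F₁₀ ⟶ F₉)
    (X : Scheme.{0}) (σ : X ⟶ P) (S : Set X) (jG : F₉ ⟶ X) (tG : F₉ ⟶ Spec (.of k)) (𝓢 K : X.IdealSheafData)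
    (hmem : TCPlus.MemberS₀At O k θ P q Y Ch F₉ T₉ Z₉ S₉ ∅ X σ S jG tG 𝓢 K) (hZinf : Z₉.Infinite) (hK₉ : K₉ = ∅)
    -- downstairs side facts of the plane: closed, `Z₉` nowhere dense in it, not containing the running curve
    (hScl : IsClosed S₉) (hSdense : S₉ ⊆ closure (S₉ \ Z₉)) (hTS₉ : ¬ T₉ ⊆ S₉)
    (hZT : Z₉ ⊆ T₉) (hTZ : ¬ T₉ ⊆ Z₉) (hυ' : IsBlowup υ' (vanishingIdeal ⟨Z₉, hZ₉⟩))
    -- STAND-IN (owner res-L1-w45b-stub-2 / res-type-027): the ruled-surface datum of the new exceptional surface, root = this step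
    (hRuled : ∀ (X : Scheme.{0}) (σ : X ⟶ P) (S : Set X) (jG : F₉ ⟶ X) (tG : F₉ ⟶ Spec (.of k)) (𝓢 K : X.IdealSheafData)
        (X₁₀ : Scheme.{0}) (τ : X₁₀ ⟶ X) (j₁₀ : F₁₀ ⟶ X₁₀) (t₁₀ : F₁₀ ⟶ Spec (.of k)),
        Ch X σ S → IsIntegral X → IsLocallyNoetherian X → Scheme.IsRegular X → IsDominant (σ ≫ q) →
        IsPullback jG tG (σ ≫ q) (Spec.map (CommRingCat.ofHom θ)) → jG '' T₉ = S →
        (𝓢 ⊔ K).comap jG = vanishingIdeal ⟨Z₉, hZ₉⟩ → Flat ((𝓢 ⊔ K).subschemeι ≫ σ ≫ q) → Scheme.IsRegular (𝓢 ⊔ K).subscheme →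
        Scheme.IsRegular 𝓢.subscheme → IsBlowup τ (𝓢 ⊔ K) → IsPullback j₁₀ t₁₀ ((τ ≫ σ) ≫ q) (Spec.map (CommRingCat.ofHom θ)) →
        j₁₀ ≫ τ = υ' ≫ jG →
        Ruled F₉ Z₉ hZ₉ F₁₀ υ' F₁₀ (𝟙 F₁₀) (υ' ⁻¹' Z₉) X₁₀ (τ ≫ σ) j₁₀ ((𝓢 ⊔ K).comap τ))
    -- STAND-IN (S): the ruled-surface datum of the SEEDED MEMBER `St S₉`, model `St_{𝓢 ⊔ K} 𝓢` (at `FE`: T-STFLAT-GEN, see `…_FE` below)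
    (hRuledS : ∀ (X : Scheme.{0}) (σ : X ⟶ P) (S : Set X) (jG : F₉ ⟶ X) (tG : F₉ ⟶ Spec (.of k)) (𝓢 K : X.IdealSheafData)
        (X₁₀ : Scheme.{0}) (τ : X₁₀ ⟶ X) (j₁₀ : F₁₀ ⟶ X₁₀) (t₁₀ : F₁₀ ⟶ Spec (.of k)),
        Ch X σ S → IsIntegral X → IsLocallyNoetherian X → Scheme.IsRegular X → IsDominant (σ ≫ q) →
        IsPullback jG tG (σ ≫ q) (Spec.map (CommRingCat.ofHom θ)) → jG '' T₉ = S →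
        (𝓢 ⊔ K).comap jG = vanishingIdeal ⟨Z₉, hZ₉⟩ → Flat ((𝓢 ⊔ K).subschemeι ≫ σ ≫ q) → Scheme.IsRegular (𝓢 ⊔ K).subscheme →
        Scheme.IsRegular 𝓢.subscheme → IsBlowup τ (𝓢 ⊔ K) → IsPullback j₁₀ t₁₀ ((τ ≫ σ) ≫ q) (Spec.map (CommRingCat.ofHom θ)) →
        j₁₀ ≫ τ = υ' ≫ jG →
        𝓢.comap jG = vanishingIdeal ⟨closure S₉, isClosed_closure⟩ → Flat (𝓢.subschemeι ≫ σ ≫ q) →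
        Ruled F₉ Z₉ hZ₉ F₁₀ υ' F₁₀ (𝟙 F₁₀) (closure (υ' ⁻¹' (S₉ \ Z₉))) X₁₀ (τ ≫ σ) j₁₀ (strictTransformIdeal τ (𝓢 ⊔ K) 𝓢)) :
    ∃ (X₂ : Scheme.{0}) (τ : X₂ ⟶ X) (j₂ : F₁₀ ⟶ X₂) (t₂ : F₁₀ ⟶ Spec (.of k)),
      IsBlowup τ (𝓢 ⊔ K) ∧ j₂ ≫ τ = υ' ≫ jG ∧ IsPullback j₂ t₂ ((τ ≫ σ) ≫ q) (Spec.map (CommRingCat.ofHom θ)) ∧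
      (𝓢 ⊔ K).comap jG = vanishingIdeal ⟨Z₉, hZ₉⟩ ∧ Scheme.IsRegular (𝓢 ⊔ K).subscheme ∧ 𝓢 ⊔ K ≠ ⊥ ∧
      IsIntegral F₁₀ ∧ IsIrreducible (closure (υ' ⁻¹' (T₉ \ Z₉))) ∧ ¬ closure (υ' ⁻¹' (T₉ \ Z₉)) ⊆ υ' ⁻¹' Z₉ ∧
      ¬ closure (υ' ⁻¹' (T₉ \ Z₉)) ⊆ closure (υ' ⁻¹' (S₉ \ Z₉)) ∧
      Ch X₂ (τ ≫ σ) (j₂ '' closure (υ' ⁻¹' (T₉ \ Z₉))) ∧ IsIntegral X₂ ∧ IsLocallyNoetherian X₂ ∧ Scheme.IsRegular X₂ ∧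
      IsDominant ((τ ≫ σ) ≫ q) ∧
      (∀ hE : IsClosed (υ' ⁻¹' Z₉),
        Tower.Exc₄ O P q Y Ruled Z₉ hZ₉ υ' F₁₀ (𝟙 F₁₀) (υ' ⁻¹' Z₉) hE (closure (υ' ⁻¹' (K₉ \ Z₉))) X₂ (τ ≫ σ) j₂) ∧
      (∀ hF : IsClosed (closure (υ' ⁻¹' (S₉ \ Z₉))),
        Tower.Exc₄ O P q Y Ruled Z₉ hZ₉ υ' F₁₀ (𝟙 F₁₀) (closure (υ' ⁻¹' (S₉ \ Z₉))) hF ∅ X₂ (τ ≫ σ) j₂) := by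
  classical
  obtain ⟨hCh, hXint, hXnoeth, hXreg, hdom, hsq, hTS, hi, hii, hiii, hiiip, hiv, hv, -, hviii, hix, hSflat⟩ := hmem
  haveI := hXint
  haveI := hXnoeth
  -- the closed carrier curve
  have hZcl : (⟨closure Z₉, isClosed_closure⟩ : Closeds F₉) = ⟨Z₉, hZ₉⟩ := Closeds.ext hZ₉.closure_eq
  have hCD : (𝓢 ⊔ K).comap jG = vanishingIdeal ⟨Z₉, hZ₉⟩ := by rw [← hZcl]; exact hi
  -- properness of the stage
  obtain ⟨-, -, hσ⟩ := chain_isRegular P Y X σ S (hChain _ _ _ hCh) hPnoeth hPreg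
  haveI := hσ
  haveI : IsProper (σ ≫ q) := inferInstance
  -- the model square: `jG` is a closed immersion onto the special fibre
  haveI : IsClosedImmersion (Spec.map (CommRingCat.ofHom θ)) := IsClosedImmersion.spec_of_surjective _ hθ
  haveI hjci : IsClosedImmersion jG := MorphismProperty.IsStableUnderBaseChange.of_isPullback hsq.flip inferInstance
  have hjsp : ∀ z : F₉, (σ ≫ q) (jG z) = closedPoint O := fun z => by
    have h1 : jG z ∈ Set.range jG := ⟨z, rfl⟩
    rw [range_eq_preimage_of_isPullback hsq, range_specMap_of_surjective_of_field θ hθ] at h1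
    exact h1
  -- the centre `𝒞 = 𝓢 ⊔ K` is regular: regular quotient stalks over the closed point + properness
  have hCreg_pt : ∀ x ∈ ((𝓢 ⊔ K).support : Set X), (σ ≫ q) x = closedPoint O →
      IsRegularLocalRing (X.presheaf.stalk x ⧸ stalkIdeal (𝓢 ⊔ K) x) := fun x hx hqx => (hv x hx hqx (by simp)).1
  haveI : IsProper ((𝓢 ⊔ K).subschemeι ≫ σ ≫ q) := inferInstance
  have hCreg : Scheme.IsRegular (𝓢 ⊔ K).subscheme :=
    Scheme.isRegular_subscheme_of_forall_over_closedPoint (σ ≫ q) (𝓢 ⊔ K) fun x hx hqx => hCreg_pt x hx hqx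
  -- support bookkeeping downstairs
  have hsuppZ : ((vanishingIdeal ⟨Z₉, hZ₉⟩ : F₉.IdealSheafData).support : Set F₉) = Z₉ := Scheme.IdealSheafData.coe_support_vanishingIdeal _
  have hDT : ((vanishingIdeal ⟨Z₉, hZ₉⟩ : F₉.IdealSheafData).support : Set F₉) ⊆ T₉ := by rw [hsuppZ]; exact hZT
  have hTD : ¬ T₉ ⊆ ((vanishingIdeal ⟨Z₉, hZ₉⟩ : F₉.IdealSheafData).support : Set F₉) := by rw [hsuppZ]; exact hTZ
  -- blow up the centre and run the model step
  obtain ⟨X₂, τ, hτ⟩ := exists_isBlowup X (𝓢 ⊔ K)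
  obtain ⟨hint₂, hnoeth₂, hreg₂, hdom₂, hF₂, hirr, j₂, t₂, hsq₂, hcomm, hCh₂⟩ :=
    modelStep_chain O k θ hθ P q Y hYirr hYcl Ch hChain hStep X σ S hCh hXreg hdom F₉ jG tG hsq T₉ hTS (𝓢 ⊔ K)
      (vanishingIdeal ⟨Z₉, hZ₉⟩) hCD hCreg hii hiv hDT hTD X₂ τ hτ F₁₀ υ' hυ'
  rw [hsuppZ] at hirr hCh₂
  haveI := hint₂
  haveI := hnoeth₂
  haveI := hF₂
  haveI : IsProper τ := hτ.isProper
  -- the cartesian model square of the step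
  have hcart : IsPullback j₂ υ' τ jG := isPullback_of_model_squares θ hθ (σ ≫ q) τ jG tG hsq j₂ t₂
    (by simpa only [Category.assoc] using hsq₂) υ' hcomm
  -- a point of `F₁₀` off the exceptional surface, and `T₁₀ ⊄ E₁₀`
  obtain ⟨t, htT, htZ⟩ := Set.not_subset.mp hTZ
  obtain ⟨t', ht'⟩ := hυ'.exists_preimage_of_not_mem_support (z := t) (by rw [hsuppZ]; exact htZ)
  have hTE : ¬ closure (υ' ⁻¹' (T₉ \ Z₉)) ⊆ υ' ⁻¹' Z₉ := by
    intro h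
    have h1 : t' ∈ closure (υ' ⁻¹' (T₉ \ Z₉)) :=
      subset_closure (show υ' t' ∈ T₉ \ Z₉ by rw [ht']; exact ⟨htT, htZ⟩)
    have h2 : υ' t' ∈ Z₉ := h h1
    rw [ht'] at h2
    exact htZ h2
  -- quasi-regular frames of the centre at the special points of `Z₉`
  have hqr : ∀ z ∈ ((⟨Z₉, hZ₉⟩ : Closeds F₉) : Set F₉), ∃ (n : ℕ) (c : Fin n → X.presheaf.stalk (jG z)),
      Ideal.span (Set.range c) = stalkIdeal (𝓢 ⊔ K) (jG z) ∧ IsQuasiRegular c := by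
    intro z hz
    have hzC : jG z ∈ ((𝓢 ⊔ K).support : Set X) := by
      have h1 : z ∈ (((𝓢 ⊔ K).comap jG).support : Set F₉) := by rw [hCD, hsuppZ]; exact hz
      rw [Scheme.IdealSheafData.support_comap] at h1
      exact h1
    haveI : IsRegularLocalRing (X.presheaf.stalk (jG z)) := hXreg (jG z)
    haveI : IsRegularLocalRing (X.presheaf.stalk (jG z) ⧸ stalkIdeal (𝓢 ⊔ K) (jG z)) := hCreg_pt _ hzC (hjsp z)
    obtain ⟨n, c, -, hc, hq, -⟩ := exists_isQuasiRegular_span_eq_of_isRegularLocalRing_quotient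
      (J := stalkIdeal (𝓢 ⊔ K) (jG z)) ((mem_support_iff_stalkIdeal_le _ _).mp hzC) (stalkIdeal (𝓢 ⊔ K) (jG z) : Set _)
      (Ideal.span_eq _)
    exact ⟨n, c, hc, hq⟩
  -- (e-i) exact reduced trace of the new exceptional surface
  have he1 : ((𝓢 ⊔ K).comap τ).comap j₂ = vanishingIdeal ⟨υ' ⁻¹' Z₉, hZ₉.preimage υ'.continuous⟩ :=
    comap_comap_eq_vanishingIdeal_preimage_of_model O k θ hθ (σ ≫ q) jG tG hsq (𝓢 ⊔ K) τ hτ j₂ t₂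
      (by simpa only [Category.assoc] using hsq₂) υ' hcomm ⟨Z₉, hZ₉⟩ hCD hqr
  -- (e-ii) locally principal
  have he2 : ∀ z : X₂, (stalkIdeal ((𝓢 ⊔ K).comap τ) z).IsPrincipal := fun z => by
    obtain ⟨u, -, hu⟩ := hτ.isEffectiveCartier.exists_stalkIdeal_eq_span z
    exact ⟨⟨u, by rw [hu, Ideal.submodule_span_eq]⟩⟩
  -- (e-iii) regular
  have he3 : Scheme.IsRegular ((𝓢 ⊔ K).comap τ).subscheme := hτ.isRegular_subscheme_comap hXreg hCreg
  -- (e-iv) off the generic point of `Y`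
  have he4 : (τ ≫ σ) '' (((𝓢 ⊔ K).comap τ).support : Set X₂) ⊆ {p : P | ¬ IsGenericPoint p Y} := by
    rintro _ ⟨z, hz, rfl⟩
    rw [Scheme.IdealSheafData.support_comap] at hz
    exact hiv ⟨τ z, hz, rfl⟩
  -- the centre is non-zero (a point of `F₁₀` off the exceptional surface)
  have hCne : 𝓢 ⊔ K ≠ ⊥ := by
    rintro hbot
    obtain ⟨u, hu, hKu⟩ := hτ.isEffectiveCartier.exists_stalkIdeal_eq_span (j₂ t')
    rw [hbot, Scheme.IdealSheafData.comap_bot, stalkIdeal_bot, eq_comm, Ideal.span_singleton_eq_bot] at hKu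
    rw [hKu] at hu
    exact zero_notMem_nonZeroDivisors hu
  -- ===================== THE SEEDED MEMBER `St S₉` WITH MODEL `𝓕 := St_{𝓢 ⊔ K} 𝓢` (T23-A″-S, shadow-free arm) =====================
  -- the cone is non-zero even though its shadow is forgotten: `K = ⊥` would make the plane's trace the curve's (`𝓘⟨S₉⟩ = 𝓘⟨Z₉⟩`),
  -- contradicting «`Z₉` nowhere dense in `S₉`» (with `Z₉` infinite)
  have hSc : (⟨closure S₉, isClosed_closure⟩ : Closeds F₉) = ⟨S₉, hScl⟩ := Closeds.ext hScl.closure_eq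
  have hKne' : K ≠ ⊥ := by
    intro hK0
    have h1 : 𝓢.comap jG = vanishingIdeal ⟨Z₉, hZ₉⟩ := by rw [← hCD, hK0, sup_bot_eq]
    have h2 : S₉ = Z₉ := by
      have h := congrArg (fun I : F₉.IdealSheafData => (I.support : Set F₉)) ((hSc ▸ hix).symm.trans h1)
      simp only [Scheme.IdealSheafData.coe_support_vanishingIdeal] at h
      exact h
    obtain ⟨z, hz⟩ := hZinf.nonempty
    have h4 : z ∈ closure (S₉ \ Z₉) := hSdense (by rw [h2]; exact hz)
    rw [h2, Set.sdiff_eq_empty.mpr (le_refl Z₉), closure_empty] at h4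
    exact h4
  -- the co-host Cartier hypothesis `K|_{V(𝓢)}` effective Cartier: clause (viii) swapped (𝓢, K locally principal, `V(𝓢)` regular, `K ≠ ⊥`)
  have hK𝓢 : IsEffectiveCartier (K.comap 𝓢.subschemeι) :=
    isEffectiveCartier_comap_subschemeι_swap 𝓢 K (fun z => (hiiip z).1) (fun z => (hiiip z).2) hiii hKne' hviii
  -- (e-i) the member's trace: `(St 𝓢)·𝒪_{F₁₀} = 𝓘⟨closure υ'⁻¹(S₉ ∖ Z₉)⟩` (exceptional transport through the cone round `𝓔 := 𝓢`)
  have hf1 : (strictTransformIdeal τ (𝓢 ⊔ K) 𝓢).comap j₂ =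
      vanishingIdeal (⟨closure (υ' ⁻¹' (S₉ \ Z₉)), isClosed_closure⟩ : Closeds F₁₀) := by
    have h := coneRound_exceptional_comap 𝓢 K hK𝓢 hτ hcart ⟨S₉, hScl⟩ ⟨Z₉, hZ₉⟩ (by rw [← hSc]; exact hix) hυ' hSdense
    exact h
  -- (e-ii) locally principal
  have hf2 : ∀ z : X₂, (stalkIdeal (strictTransformIdeal τ (𝓢 ⊔ K) 𝓢) z).IsPrincipal := fun z =>
    isPrincipal_stalkIdeal_strictTransformIdeal hXreg hCreg hτ hCne 𝓢 (fun z => (hiiip z).1) z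
  -- (e-iii) regular: `V(St 𝓢) ≅ V(𝓢)`
  obtain ⟨eS, heS⟩ := exists_iso_subscheme_strictTransformIdeal_exceptional 𝓢 K hK𝓢 hτ
  have hf3 : Scheme.IsRegular (strictTransformIdeal τ (𝓢 ⊔ K) 𝓢).subscheme := Scheme.IsRegular.of_isOpenImmersion eS.hom hiii
  -- (e-iv) off the generic point of `Y`
  have h𝓢off : σ '' (𝓢.support : Set X) ⊆ {p : P | ¬ IsGenericPoint p Y} :=
    image_support_subset_not_isGenericPoint_of_chain θ hθ q Y hYsp σ S (hChain _ _ _ hCh) jG tG hsq T₉ hTS 𝓢 (closure S₉)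
      isClosed_closure hix (fun h => hTS₉ (h.trans hScl.closure_subset))
  have hf4 : (τ ≫ σ) '' ((strictTransformIdeal τ (𝓢 ⊔ K) 𝓢).support : Set X₂) ⊆ {p : P | ¬ IsGenericPoint p Y} := by
    rintro _ ⟨z, hz, rfl⟩
    rw [Scheme.Hom.comp_apply]
    exact h𝓢off ⟨τ z, apply_mem_support_of_mem_support_strictTransformIdeal 𝓢 hz, rfl⟩
  -- downstairs bookkeeping of the member: NOT containing the new running curve (`T₉` irreducible, `⊄ S₉`, `⊄ Z₉`)
  have hTS₁₀ : ¬ closure (υ' ⁻¹' (T₉ \ Z₉)) ⊆ closure (υ' ⁻¹' (S₉ \ Z₉)) := by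
    intro hsub
    have hTSZ : ¬ T₉ ⊆ S₉ ∪ Z₉ := fun h => by
      rcases (isPreirreducible_iff_isClosed_union_isClosed.mp hT₉irr.isPreirreducible) _ _ hScl hZ₉ h with h' | h'
      · exact hTS₉ h'
      · exact hTZ h'
    obtain ⟨u, huT, hu⟩ := Set.not_subset.mp hTSZ
    have huS : u ∉ S₉ := fun h => hu (Or.inl h)
    have huZ : u ∉ Z₉ := fun h => hu (Or.inr h)
    obtain ⟨u', hu'⟩ := hυ'.exists_preimage_of_not_mem_support (z := u) (by rw [hsuppZ]; exact huZ)
    have h1 : u' ∈ closure (υ' ⁻¹' (T₉ \ Z₉)) := subset_closure (show υ' u' ∈ T₉ \ Z₉ by rw [hu']; exact ⟨huT, huZ⟩)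
    have h2 : u' ∈ υ' ⁻¹' S₉ :=
      (closure_minimal (fun z hz => hz.1) (hScl.preimage υ'.continuous) : closure (υ' ⁻¹' (S₉ \ Z₉)) ⊆ υ' ⁻¹' S₉) (hsub h1)
    rw [Set.mem_preimage, hu'] at h2
    exact huS h2
  -- assemble (explicit outputs; `Exc₄` data)
  exact ⟨X₂, τ, j₂, t₂, hτ, hcomm, hsq₂, hCD, hCreg, hCne, hF₂, hirr, hTE, hTS₁₀, hCh₂, hint₂, hnoeth₂, hreg₂, hdom₂,
    fun hE => ⟨(𝓢 ⊔ K).comap τ, he1, he2, he3, he4,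
      hRuled X σ S jG tG 𝓢 K X₂ τ j₂ t₂ hCh hXint hXnoeth hXreg hdom hsq hTS hCD hii hCreg hiii hτ hsq₂ hcomm, Or.inl (by subst hK₉; simp)⟩,
    fun hF => ⟨strictTransformIdeal τ (𝓢 ⊔ K) 𝓢, hf1, hf2, hf3, hf4,
      hRuledS X σ S jG tG 𝓢 K X₂ τ j₂ t₂ hCh hXint hXnoeth hXreg hdom hsq hTS hCD hii hCreg hiii hτ hsq₂ hcomm hix hSflat, Or.inl rfl⟩⟩

end Summit.ResolutionOfSingularities.ResolutionOfSingularities.Cruxes.EquisingularLiftNat.Sections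

end
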